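import Summits.SmoothPoincare4.SmoothPoincare4.Theorems.HeegaardHandlebodyCongruenceClosed.Negative.OneLevel

/-!
# `HeegaardHandlebodyCongruenceClosed` — negative-side support (4/5): handle-mixing Dehn twists

`T_A`, `T_B ∈ Aut S₃`: the Dehn twists along curves of classes `a₀+a₁`, `b₀+b₁` joining handles 0 and
1, found by a Whitehead-graph search for the stabiliser of the cyclic word `[a₀,b₀][a₁,b₁]` in `Aut F₄`
and normalised by a partial conjugation so that they fix `[a₀,b₀][a₁,b₁]` (hence the surface relator) on
the nose; and the separating twist `T_{δ₀}` (`P0`, partial conjugation of handle 0 by `δ₀ = [a₀,b₀]`).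
All as `MulEquiv`s with their values on generators. [folklore]
-/

namespace Summit.SmoothPoincare4.SmoothPoincare4.Theorems.HeegaardHandlebodyCongruenceClosed.Negative

open Literature.Topology.FourManifolds Subgroup

section GenusThree

open SurfaceGroup
open Summit.SmoothPoincare4.SmoothPoincare4.Theorems.ShadowApproximation.Negative
  (surfaceRelator_three of_eq_a of_eq_b rel_three lift_surfaceRelator_three liftHom liftHom_of
    liftHom_a liftHom_b)

/-! ## Handle-mixing twists and a Johnson-kernel witness (genus 3)

The automorphisms below were FOUND by a Whitehead-graph search for stabilisers of the cyclic word
`[a₀,b₀][a₁,b₁]` in `Aut F₄` (py/whitehead.py in the seat folder) and normalised by a partial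
conjugation; every identity used is a free-group identity, re-verified here by `group`. -/


/-- generator images of `ta` [folklore] -/
def taFun (p : surfaceGen 3) : SurfaceGroup 3 :=
  if p = ((0, false) : surfaceGen 3) then (a 1)⁻¹ * a 0 * a 1
  else if p = ((0, true) : surfaceGen 3) then (a 1)⁻¹ * (a 0)⁻¹ * a 1 * a 0 * b 0 * a 0 * a 1
  else if p = ((1, false) : surfaceGen 3) then (a 1)⁻¹ * (a 0)⁻¹ * a 1 * a 0 * a 1
  else if p = ((1, true) : surfaceGen 3) then b 1 * a 0 * a 1
  else PresentedGroup.of p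

/-- generator images of `taInv` [folklore] -/
def taInvFun (p : surfaceGen 3) : SurfaceGroup 3 :=
  if p = ((0, false) : surfaceGen 3) then a 0 * a 1 * a 0 * (a 1)⁻¹ * (a 0)⁻¹
  else if p = ((0, true) : surfaceGen 3) then a 0 * a 1 * (a 0)⁻¹ * (a 1)⁻¹ * b 0 * (a 1)⁻¹ * (a 0)⁻¹
  else if p = ((1, false) : surfaceGen 3) then a 0 * a 1 * (a 0)⁻¹
  else if p = ((1, true) : surfaceGen 3) then b 1 * (a 1)⁻¹ * (a 0)⁻¹
  else PresentedGroup.of p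

/-- helper lemma `taFun_rel` (see the module docstring). [folklore] -/
theorem taFun_rel : FreeGroup.lift taFun (surfaceRelator 3) = 1 := by
  rw [lift_surfaceRelator_three, ← rel_three]
  simp [taFun, of_eq_a, of_eq_b]
  group

/-- helper lemma `taInvFun_rel` (see the module docstring). [folklore] -/
theorem taInvFun_rel : FreeGroup.lift taInvFun (surfaceRelator 3) = 1 := by
  rw [lift_surfaceRelator_three, ← rel_three]
  simp [taInvFun, of_eq_a, of_eq_b]
  group

/-- `TA` as a hom [folklore] -/
def taHom : SurfaceGroup 3 →* SurfaceGroup 3 := liftHom taFun taFun_rel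
/-- `TA⁻¹` as a hom [folklore] -/
def taInvHom : SurfaceGroup 3 →* SurfaceGroup 3 := liftHom taInvFun taInvFun_rel

/-- helper lemma `taInv_comp` (see the module docstring). [folklore] -/
theorem taInv_comp : taInvHom.comp taHom = MonoidHom.id _ := by
  apply PresentedGroup.ext
  rintro ⟨i, _ | _⟩ <;> fin_cases i <;>
    simp [taHom, taInvHom, taFun, taInvFun, of_eq_a, of_eq_b]
  all_goals group

/-- helper lemma `ta_comp_inv` (see the module docstring). [folklore] -/
theorem ta_comp_inv : taHom.comp taInvHom = MonoidHom.id _ := by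
  apply PresentedGroup.ext
  rintro ⟨i, _ | _⟩ <;> fin_cases i <;>
    simp [taHom, taInvHom, taFun, taInvFun, of_eq_a, of_eq_b]
  all_goals group

/-- **`TA ∈ Aut S₃`**: the Dehn twist along a curve of class `a₀ + a₁` joining handles 0 and 1, normalised by a partial conjugation so that it fixes `[a₀,b₀][a₁,b₁]` on the nose. [folklore] -/
def TA : SurfaceGroup 3 ≃* SurfaceGroup 3 := MonoidHom.toMulEquiv taHom taInvHom taInv_comp ta_comp_inv

/-- helper lemma `TA_a0` (see the module docstring). [folklore] -/
@[simp] theorem TA_a0 : TA (a 0) = (a 1)⁻¹ * a 0 * a 1 := by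
  simp [TA, taHom, taFun]
/-- helper lemma `TA_symm_a0` (see the module docstring). [folklore] -/
@[simp] theorem TA_symm_a0 : TA.symm (a 0) = a 0 * a 1 * a 0 * (a 1)⁻¹ * (a 0)⁻¹ := by
  simp [TA, taInvHom, taInvFun]
/-- helper lemma `TA_b0` (see the module docstring). [folklore] -/
@[simp] theorem TA_b0 : TA (b 0) = (a 1)⁻¹ * (a 0)⁻¹ * a 1 * a 0 * b 0 * a 0 * a 1 := by
  simp [TA, taHom, taFun]
/-- helper lemma `TA_symm_b0` (see the module docstring). [folklore] -/
@[simp] theorem TA_symm_b0 : TA.symm (b 0) = a 0 * a 1 * (a 0)⁻¹ * (a 1)⁻¹ * b 0 * (a 1)⁻¹ * (a 0)⁻¹ := by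
  simp [TA, taInvHom, taInvFun]
/-- helper lemma `TA_a1` (see the module docstring). [folklore] -/
@[simp] theorem TA_a1 : TA (a 1) = (a 1)⁻¹ * (a 0)⁻¹ * a 1 * a 0 * a 1 := by
  simp [TA, taHom, taFun]
/-- helper lemma `TA_symm_a1` (see the module docstring). [folklore] -/
@[simp] theorem TA_symm_a1 : TA.symm (a 1) = a 0 * a 1 * (a 0)⁻¹ := by
  simp [TA, taInvHom, taInvFun]
/-- helper lemma `TA_b1` (see the module docstring). [folklore] -/
@[simp] theorem TA_b1 : TA (b 1) = b 1 * a 0 * a 1 := by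
  simp [TA, taHom, taFun]
/-- helper lemma `TA_symm_b1` (see the module docstring). [folklore] -/
@[simp] theorem TA_symm_b1 : TA.symm (b 1) = b 1 * (a 1)⁻¹ * (a 0)⁻¹ := by
  simp [TA, taInvHom, taInvFun]
/-- helper lemma `TA_a2` (see the module docstring). [folklore] -/
@[simp] theorem TA_a2 : TA (a 2) = a 2 := by
  simp [TA, taHom, taFun, of_eq_a]
/-- helper lemma `TA_symm_a2` (see the module docstring). [folklore] -/
@[simp] theorem TA_symm_a2 : TA.symm (a 2) = a 2 := by
  simp [TA, taInvHom, taInvFun, of_eq_a]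
/-- helper lemma `TA_b2` (see the module docstring). [folklore] -/
@[simp] theorem TA_b2 : TA (b 2) = b 2 := by
  simp [TA, taHom, taFun, of_eq_b]
/-- helper lemma `TA_symm_b2` (see the module docstring). [folklore] -/
@[simp] theorem TA_symm_b2 : TA.symm (b 2) = b 2 := by
  simp [TA, taInvHom, taInvFun, of_eq_b]

/-- generator images of `tb` [folklore] -/
def tbFun (p : surfaceGen 3) : SurfaceGroup 3 :=
  if p = ((0, false) : surfaceGen 3) then a 0 * b 1 * b 0
  else if p = ((0, true) : surfaceGen 3) then (b 0)⁻¹ * (b 1)⁻¹ * b 0 * b 1 * b 0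
  else if p = ((1, false) : surfaceGen 3) then (b 0)⁻¹ * (b 1)⁻¹ * b 0 * b 1 * a 1 * b 1 * b 0
  else if p = ((1, true) : surfaceGen 3) then (b 0)⁻¹ * b 1 * b 0
  else PresentedGroup.of p

/-- generator images of `tbInv` [folklore] -/
def tbInvFun (p : surfaceGen 3) : SurfaceGroup 3 :=
  if p = ((0, false) : surfaceGen 3) then a 0 * (b 0)⁻¹ * (b 1)⁻¹
  else if p = ((0, true) : surfaceGen 3) then b 1 * b 0 * (b 1)⁻¹
  else if p = ((1, false) : surfaceGen 3) then b 1 * b 0 * (b 1)⁻¹ * (b 0)⁻¹ * a 1 * (b 0)⁻¹ * (b 1)⁻¹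
  else if p = ((1, true) : surfaceGen 3) then b 1 * b 0 * b 1 * (b 0)⁻¹ * (b 1)⁻¹
  else PresentedGroup.of p

/-- helper lemma `tbFun_rel` (see the module docstring). [folklore] -/
theorem tbFun_rel : FreeGroup.lift tbFun (surfaceRelator 3) = 1 := by
  rw [lift_surfaceRelator_three, ← rel_three]
  simp [tbFun, of_eq_a, of_eq_b]
  group

/-- helper lemma `tbInvFun_rel` (see the module docstring). [folklore] -/
theorem tbInvFun_rel : FreeGroup.lift tbInvFun (surfaceRelator 3) = 1 := by
  rw [lift_surfaceRelator_three, ← rel_three]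
  simp [tbInvFun, of_eq_a, of_eq_b]
  group

/-- `TB` as a hom [folklore] -/
def tbHom : SurfaceGroup 3 →* SurfaceGroup 3 := liftHom tbFun tbFun_rel
/-- `TB⁻¹` as a hom [folklore] -/
def tbInvHom : SurfaceGroup 3 →* SurfaceGroup 3 := liftHom tbInvFun tbInvFun_rel

/-- helper lemma `tbInv_comp` (see the module docstring). [folklore] -/
theorem tbInv_comp : tbInvHom.comp tbHom = MonoidHom.id _ := by
  apply PresentedGroup.ext
  rintro ⟨i, _ | _⟩ <;> fin_cases i <;>
    simp [tbHom, tbInvHom, tbFun, tbInvFun, of_eq_a, of_eq_b]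
  all_goals group

/-- helper lemma `tb_comp_inv` (see the module docstring). [folklore] -/
theorem tb_comp_inv : tbHom.comp tbInvHom = MonoidHom.id _ := by
  apply PresentedGroup.ext
  rintro ⟨i, _ | _⟩ <;> fin_cases i <;>
    simp [tbHom, tbInvHom, tbFun, tbInvFun, of_eq_a, of_eq_b]
  all_goals group

/-- **`TB ∈ Aut S₃`**: the Dehn twist along a curve of class `b₀ + b₁` joining handles 0 and 1, normalised likewise. [folklore] -/
def TB : SurfaceGroup 3 ≃* SurfaceGroup 3 := MonoidHom.toMulEquiv tbHom tbInvHom tbInv_comp tb_comp_inv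

/-- helper lemma `TB_a0` (see the module docstring). [folklore] -/
@[simp] theorem TB_a0 : TB (a 0) = a 0 * b 1 * b 0 := by
  simp [TB, tbHom, tbFun]
/-- helper lemma `TB_symm_a0` (see the module docstring). [folklore] -/
@[simp] theorem TB_symm_a0 : TB.symm (a 0) = a 0 * (b 0)⁻¹ * (b 1)⁻¹ := by
  simp [TB, tbInvHom, tbInvFun]
/-- helper lemma `TB_b0` (see the module docstring). [folklore] -/
@[simp] theorem TB_b0 : TB (b 0) = (b 0)⁻¹ * (b 1)⁻¹ * b 0 * b 1 * b 0 := by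
  simp [TB, tbHom, tbFun]
/-- helper lemma `TB_symm_b0` (see the module docstring). [folklore] -/
@[simp] theorem TB_symm_b0 : TB.symm (b 0) = b 1 * b 0 * (b 1)⁻¹ := by
  simp [TB, tbInvHom, tbInvFun]
/-- helper lemma `TB_a1` (see the module docstring). [folklore] -/
@[simp] theorem TB_a1 : TB (a 1) = (b 0)⁻¹ * (b 1)⁻¹ * b 0 * b 1 * a 1 * b 1 * b 0 := by
  simp [TB, tbHom, tbFun]
/-- helper lemma `TB_symm_a1` (see the module docstring). [folklore] -/
@[simp] theorem TB_symm_a1 : TB.symm (a 1) = b 1 * b 0 * (b 1)⁻¹ * (b 0)⁻¹ * a 1 * (b 0)⁻¹ * (b 1)⁻¹ := by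
  simp [TB, tbInvHom, tbInvFun]
/-- helper lemma `TB_b1` (see the module docstring). [folklore] -/
@[simp] theorem TB_b1 : TB (b 1) = (b 0)⁻¹ * b 1 * b 0 := by
  simp [TB, tbHom, tbFun]
/-- helper lemma `TB_symm_b1` (see the module docstring). [folklore] -/
@[simp] theorem TB_symm_b1 : TB.symm (b 1) = b 1 * b 0 * b 1 * (b 0)⁻¹ * (b 1)⁻¹ := by
  simp [TB, tbInvHom, tbInvFun]
/-- helper lemma `TB_a2` (see the module docstring). [folklore] -/
@[simp] theorem TB_a2 : TB (a 2) = a 2 := by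
  simp [TB, tbHom, tbFun, of_eq_a]
/-- helper lemma `TB_symm_a2` (see the module docstring). [folklore] -/
@[simp] theorem TB_symm_a2 : TB.symm (a 2) = a 2 := by
  simp [TB, tbInvHom, tbInvFun, of_eq_a]
/-- helper lemma `TB_b2` (see the module docstring). [folklore] -/
@[simp] theorem TB_b2 : TB (b 2) = b 2 := by
  simp [TB, tbHom, tbFun, of_eq_b]
/-- helper lemma `TB_symm_b2` (see the module docstring). [folklore] -/
@[simp] theorem TB_symm_b2 : TB.symm (b 2) = b 2 := by
  simp [TB, tbInvHom, tbInvFun, of_eq_b]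

/-- generator images of `p0` [folklore] -/
def p0Fun (p : surfaceGen 3) : SurfaceGroup 3 :=
  if p = ((0, false) : surfaceGen 3) then a 0 * b 0 * (a 0)⁻¹ * (b 0)⁻¹ * a 0 * b 0 * a 0 * (b 0)⁻¹ * (a 0)⁻¹
  else if p = ((0, true) : surfaceGen 3) then a 0 * b 0 * (a 0)⁻¹ * b 0 * a 0 * (b 0)⁻¹ * (a 0)⁻¹
  else if p = ((1, false) : surfaceGen 3) then a 1
  else if p = ((1, true) : surfaceGen 3) then b 1
  else PresentedGroup.of p

/-- generator images of `p0Inv` [folklore] -/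
def p0InvFun (p : surfaceGen 3) : SurfaceGroup 3 :=
  if p = ((0, false) : surfaceGen 3) then b 0 * a 0 * (b 0)⁻¹ * a 0 * b 0 * (a 0)⁻¹ * (b 0)⁻¹
  else if p = ((0, true) : surfaceGen 3) then b 0 * a 0 * (b 0)⁻¹ * (a 0)⁻¹ * b 0 * a 0 * b 0 * (a 0)⁻¹ * (b 0)⁻¹
  else if p = ((1, false) : surfaceGen 3) then a 1
  else if p = ((1, true) : surfaceGen 3) then b 1
  else PresentedGroup.of p

/-- helper lemma `p0Fun_rel` (see the module docstring). [folklore] -/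
theorem p0Fun_rel : FreeGroup.lift p0Fun (surfaceRelator 3) = 1 := by
  rw [lift_surfaceRelator_three, ← rel_three]
  simp [p0Fun, of_eq_a, of_eq_b]
  group

/-- helper lemma `p0InvFun_rel` (see the module docstring). [folklore] -/
theorem p0InvFun_rel : FreeGroup.lift p0InvFun (surfaceRelator 3) = 1 := by
  rw [lift_surfaceRelator_three, ← rel_three]
  simp [p0InvFun, of_eq_a, of_eq_b]
  group

/-- `P0` as a hom [folklore] -/
def p0Hom : SurfaceGroup 3 →* SurfaceGroup 3 := liftHom p0Fun p0Fun_rel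
/-- `P0⁻¹` as a hom [folklore] -/
def p0InvHom : SurfaceGroup 3 →* SurfaceGroup 3 := liftHom p0InvFun p0InvFun_rel

/-- helper lemma `p0Inv_comp` (see the module docstring). [folklore] -/
theorem p0Inv_comp : p0InvHom.comp p0Hom = MonoidHom.id _ := by
  apply PresentedGroup.ext
  rintro ⟨i, _ | _⟩ <;> fin_cases i <;>
    simp [p0Hom, p0InvHom, p0Fun, p0InvFun, of_eq_a, of_eq_b]
  all_goals group

/-- helper lemma `p0_comp_inv` (see the module docstring). [folklore] -/
theorem p0_comp_inv : p0Hom.comp p0InvHom = MonoidHom.id _ := by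
  apply PresentedGroup.ext
  rintro ⟨i, _ | _⟩ <;> fin_cases i <;>
    simp [p0Hom, p0InvHom, p0Fun, p0InvFun, of_eq_a, of_eq_b]
  all_goals group

/-- **`P0 ∈ Aut S₃`**: the separating twist `T_{δ₀}` about `∂(handle 0)`: partial conjugation of handle 0 by `δ₀ = [a₀,b₀]` (Johnson kernel). [folklore] -/
def P0 : SurfaceGroup 3 ≃* SurfaceGroup 3 := MonoidHom.toMulEquiv p0Hom p0InvHom p0Inv_comp p0_comp_inv

/-- helper lemma `P0_a0` (see the module docstring). [folklore] -/
@[simp] theorem P0_a0 : P0 (a 0) = a 0 * b 0 * (a 0)⁻¹ * (b 0)⁻¹ * a 0 * b 0 * a 0 * (b 0)⁻¹ * (a 0)⁻¹ := by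
  simp [P0, p0Hom, p0Fun]
/-- helper lemma `P0_symm_a0` (see the module docstring). [folklore] -/
@[simp] theorem P0_symm_a0 : P0.symm (a 0) = b 0 * a 0 * (b 0)⁻¹ * a 0 * b 0 * (a 0)⁻¹ * (b 0)⁻¹ := by
  simp [P0, p0InvHom, p0InvFun]
/-- helper lemma `P0_b0` (see the module docstring). [folklore] -/
@[simp] theorem P0_b0 : P0 (b 0) = a 0 * b 0 * (a 0)⁻¹ * b 0 * a 0 * (b 0)⁻¹ * (a 0)⁻¹ := by
  simp [P0, p0Hom, p0Fun]
/-- helper lemma `P0_symm_b0` (see the module docstring). [folklore] -/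
@[simp] theorem P0_symm_b0 : P0.symm (b 0) = b 0 * a 0 * (b 0)⁻¹ * (a 0)⁻¹ * b 0 * a 0 * b 0 * (a 0)⁻¹ * (b 0)⁻¹ := by
  simp [P0, p0InvHom, p0InvFun]
/-- helper lemma `P0_a1` (see the module docstring). [folklore] -/
@[simp] theorem P0_a1 : P0 (a 1) = a 1 := by
  simp [P0, p0Hom, p0Fun]
/-- helper lemma `P0_symm_a1` (see the module docstring). [folklore] -/
@[simp] theorem P0_symm_a1 : P0.symm (a 1) = a 1 := by
  simp [P0, p0InvHom, p0InvFun]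
/-- helper lemma `P0_b1` (see the module docstring). [folklore] -/
@[simp] theorem P0_b1 : P0 (b 1) = b 1 := by
  simp [P0, p0Hom, p0Fun]
/-- helper lemma `P0_symm_b1` (see the module docstring). [folklore] -/
@[simp] theorem P0_symm_b1 : P0.symm (b 1) = b 1 := by
  simp [P0, p0InvHom, p0InvFun]
/-- helper lemma `P0_a2` (see the module docstring). [folklore] -/
@[simp] theorem P0_a2 : P0 (a 2) = a 2 := by
  simp [P0, p0Hom, p0Fun, of_eq_a]
/-- helper lemma `P0_symm_a2` (see the module docstring). [folklore] -/
@[simp] theorem P0_symm_a2 : P0.symm (a 2) = a 2 := by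
  simp [P0, p0InvHom, p0InvFun, of_eq_a]
/-- helper lemma `P0_b2` (see the module docstring). [folklore] -/
@[simp] theorem P0_b2 : P0 (b 2) = b 2 := by
  simp [P0, p0Hom, p0Fun, of_eq_b]
/-- helper lemma `P0_symm_b2` (see the module docstring). [folklore] -/
@[simp] theorem P0_symm_b2 : P0.symm (b 2) = b 2 := by
  simp [P0, p0InvHom, p0InvFun, of_eq_b]

end GenusThree

end Summit.SmoothPoincare4.SmoothPoincare4.Theorems.HeegaardHandlebodyCongruenceClosed.Negative
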